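import Literature.MathematicalPhysics.QuantumFieldTheory.Balaban1983to89.Node00.CriticalOnFibreTopGuarded
import Summits.QuantumFields.YangMills.Theorems.BalabanUVNodesN07LocalLettersCoreFloor

/-!
# BalabanUVNodes ∕ N07 — THE S6 TOKENS WITH A GUARD: guard-generic twins (`… → 0 < ν.M₁ → Adm ν M g K k s → …`, `Adm : StepGuard F`) of the four S6 interface tokens,
# with `.toG`, antitonicity, guard monotonicity `.of_imp`, the `floorGuard` bridges to the floor-carrying editions (p621398), and the same compositions into n07-e's
# `HalvingStepTopCoreG` (module 47) — the ONE SLOT for both located guards (the `M₁` floor of LOCATED-STUB1-FLOOR and the level guard of LOCATED-UNGUARDED-LEVELS)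

Cell `pub-ymgap`, width seat `pub-ymgap-dag-n07-w4` gen 3 (director-ym №197 ∕ HUMAN RULING D-0149); node N07 = [15] = [Balaban1985Variational]; CLAIM-8 ∕ INTENT-9 of 2026-08-28
(bus I.35675).  `--supports stmt-QuantumFields-26907 --as helper`; four displayed `Prop` tokens, NEVER asserted, + theorems; CONSUMED BY NAME: n07-e module 47, this seat's p621398.

WHY.  Two located binder-block findings (n07-e's LOCATED-STUB1-FLOOR: the `M₁` floor; this seat's LOCATED-UNGUARDED-LEVELS: the level guard) ask for ONE extra binder slot
before the thresholds; n07-e's module 47 types it guard-generically (`Adm : StepGuard F`; `floorGuard c` an instance).  THIS FILE is the head's side in that currency: the four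
S6 tokens with a guard, their compositions into `HalvingStepTopCoreG`, and the bridges `…R c ↔ …G (floorGuard c)` to p621398 — so the knit lands in `…G Adm` for (R-b)'s guard.

CONTENTS.  §1–§4 the four `…G` tokens with `.toG ∕ .of_le ∕ .of_imp` and ★★ `halvingStepTopCoreG_of_localLetters165CoreG ∕ …SplitCoreG`, ★★★ `localLetters165CoreG_of_datumGauge165CoreG ∕
localLettersSplitCoreG_of_datumGaugeSplitCoreG`, ★★ `halvingStepTopCoreG_of_datumGauge165CoreG ∕ …SplitCoreG`; §5 the four `…R_iff_G_floorGuard` bridges (definitional).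

HONEST FRAMING: binder-threading bookkeeping; displayed `Prop`s never asserted; guard-free tokens NOT claimed false; NOTHING of Bałaban's analysis proved; stub 1 ∕ K0⁷ ∕ K1⁸
NOT closed; N07 NOT discharged; counts unmoved; R4 = the conditional finite-𝕋⁴ rung ONLY; the YM mass gap (Clay) is NOT proved; nothing continuum ∕ ℝ⁴ ∕ OS.  Four `def`s, no `sorry`.
-/

noncomputable section

namespace Summit.QuantumFields.YangMills.BalabanUVNodes.N07LocalLettersCoreGuarded

open scoped Matrix.Norms.L2Operator
open Literature.MathematicalPhysics.QuantumFieldTheory.Balaban1983to89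
open Literature.MathematicalPhysics.QuantumFieldTheory.Balaban1983to89.Node00
open Literature.MathematicalPhysics.QuantumFieldTheory.Balaban1983to89.T4Continuum (T4Family)
open Literature.MathematicalPhysics.QuantumFieldTheory.Balaban1983to89.B15DeterminingSets
open B15Eq112TorusCover (cover lift)
open B14DomainGeom (Pt Within cubeIdx)
open B14.Eq213MaximalDomains (side cubeExt)
open B8Eq131Cubes (box)
open Summit.QuantumFields.YangMills.BalabanUVNodes.N07HalvingStepTopOfLocalLetters (radius_descend threshold167_of_budget165)
open Summit.QuantumFields.YangMills.BalabanUVNodes.N07LocalLettersCoreOfDatumGauges (mem_cubeExt_cubeIdx exists_within_three_of_mem_plaqsOf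
  exists_within_three_of_not_mem_bondsDeep_compl)
open Summit.QuantumFields.YangMills.BalabanUVNodes.N07LocalLettersSplitCore (LocalGaugeSplitOn regularTwo_of_localGaugeSplitOn thresholdSplit_plaq thresholdSplit_bond)
open Summit.QuantumFields.YangMills.BalabanUVNodes.N07LocalLettersCoreFloor

/-! ## §0  Plumbing -/

/-- `0 < η_i ≤ 1`. [cite: Balaban1987RG1, (1.1) p.260 (bookkeeping)] -/
private theorem eta_pos_le_one' (P : Params) (i : ℕ) : 0 < P.eta i ∧ P.eta i ≤ 1 := by
  have hL : (1 : ℝ) ≤ P.L := by exact_mod_cast P.L_pos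
  unfold Params.eta
  exact ⟨pow_pos (inv_pos.mpr (lt_of_lt_of_le one_pos hL)) i, pow_le_one₀ (inv_nonneg.mpr (zero_le_one.trans hL)) (inv_le_one_of_one_le₀ hL)⟩

/-- The tree's (168) side conditions from `64·t ≤ max{B₃δ, ½ε} ≤ ε ≤ a₀ ≤ ½` at `d = 4`. [cite: Balaban1985Variational, (166)–(168) p.304 (bookkeeping)] -/
private theorem thresholds168' {d : ℕ} (hd : d = 4) {B₃ δi εi a₀ t : ℝ} (hB₃ : 0 ≤ B₃) (hδi : 0 < δi) (hε : B₃ * δi ≤ εi ∧ εi ≤ a₀)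
    (ha₀ : 2 * a₀ ≤ 1) (ht : 64 * t ≤ max (B₃ * δi) (εi / 2)) :
    32 * (d : ℝ) * t ≤ 1 ∧ 32 * t ≤ max (B₃ * δi) (εi / 2) ∧ 2 * t ≤ max (B₃ * δi) (εi / 2) := by
  have hr0 : 0 ≤ max (B₃ * δi) (εi / 2) := le_max_of_le_left (mul_nonneg hB₃ hδi.le)
  have hε0 : 0 ≤ εi := (mul_nonneg hB₃ hδi.le).trans hε.1
  have hrε : max (B₃ * δi) (εi / 2) ≤ εi := max_le hε.1 (by linarith)
  subst hd
  push_cast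
  by_cases h0 : 0 ≤ t
  · exact ⟨by linarith [hε.2], by linarith, by linarith⟩
  · have h0' : t < 0 := lt_of_not_ge h0
    exact ⟨by linarith, by linarith, by linarith⟩

/-! ## §1  The (165)-token with a floor -/

section Token165R

variable (F : T4Family) (N : ℕ) [NeZero N]

/-- **[15] (165) IN A LOCAL GAUGE AROUND EVERY CORE PLAQUETTE ∕ BOND — TOKEN FORM WITH A GUARD `Adm`**: p587134's `LocalLetters165TopStepCore` with ONE more binder `Adm ν M g K k s`
after `0 < ν.M₁` (n07-e's module-47 pattern, byte for byte with `HalvingStepTopCoreG`).  A `Prop`, NEVER asserted.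
[cite: Balaban1985Variational, (165) p.304, (144) p.300; Balaban1985RegularSpaces, (1.3)–(1.6) p.77 («R … fixed later»)] -/
def LocalLetters165TopStepCoreG (Sup : (ν : Stage7Numerics) → (K : ℕ) → (ℕ → Set (Site (F.P K) 0)) → Set (Site (F.P K) 0)) (Adm : StepGuard F) (B₃ C θ Q a₀ a₁ : ℝ) : Prop :=
  ∀ (ν : Stage7Numerics) (M : ℕ) (g : ℕ → ℝ) (K k : ℕ) (s : SeqOfRecord F ν M g K k), Sect2.SeqSeparated ν.M₁ s → 0 < ν.M₁ → Adm ν M g K k s → 1 ≤ k →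
    ∀ (ε δ : ℕ → ℝ),
    (∀ n, n ≤ k → 0 < δ n ∧ δ n ≤ a₁) → (∀ n, n < k → δ n ≤ 2 * δ (n + 1)) → (∀ n, n < k → δ (n + 1) ≤ 2 * δ n) →
    (∀ n, n ≤ k → B₃ * δ n ≤ ε n ∧ ε n ≤ a₀) → (∀ n, n < k → ε n ≤ 2 * ε (n + 1)) → (∀ n, n < k → ε (n + 1) ≤ 2 * ε n) →
    ∀ W : MSField (F.P K) (SU N), Sect2.DataSmall7PTop (avOfRecord F N K) s.Ω (Sup ν K s.Ω) k δ W →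
      ∀ U : GaugeField (F.P K) 0 (SU N),
        (∀ n, n ≤ k → PlaqSmallOn (Sect2.omegaPlaqsTop s.Ω (Sup ν K s.Ω) n) (ε n * (F.P K).eta n ^ 2) U) →
        (∀ n, n ≤ k → Sect2.CoDivSmallOn (Sect2.omegaBondsTop s.Ω (Sup ν K s.Ω) n) (ε n * (F.P K).eta n ^ 3) U) →
        AgreeOn (genSet s.Ω k) (avgFamily (avOfRecord F N K) U) W →
        IsCritOnFibre F N K (genSet s.Ω k) W U →
        ∀ m, m ≤ k →
          (∀ p ∈ Sect2.omegaPlaqsTop s.Ω (Sup ν K s.Ω) m, p ∉ Sect2.printedPlaqs s.Ω k 0 →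
            ∃ (Y : Set (Site (F.P K) 0)) (i : ℕ), m ≤ i ∧ i ≤ k ∧ p ∈ plaqInside Y ∧
              Sect2.LocalGauge10On Y ((F.P K).eta i) (C * δ i + θ * ε i + Q * ε i ^ 2) U) ∧
          (∀ b ∈ Sect2.omegaBondsTop s.Ω (Sup ν K s.Ω) m, b ∉ Sect2.bondsDeep (s.Ω 1)ᶜ →
            ∃ (Y : Set (Site (F.P K) 0)) (i : ℕ), m ≤ i ∧ i ≤ k ∧ b ∈ Sect2.bondsDeep Y ∧
              Sect2.LocalGauge10On Y ((F.P K).eta i) (C * δ i + θ * ε i + Q * ε i ^ 2) U)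

variable {F N}

/-- Guard-free ⇒ guarded, every guard. [cite: Balaban1985Variational, (165) p.304 (bookkeeping)] -/
theorem LocalLetters165TopStepCore.toG {Sup : (ν : Stage7Numerics) → (K : ℕ) → (ℕ → Set (Site (F.P K) 0)) → Set (Site (F.P K) 0)} {B₃ C θ Q a₀ a₁ : ℝ}
    (h : N07HalvingStepTopCoreOfLocalLetters.LocalLetters165TopStepCore F N Sup B₃ C θ Q a₀ a₁) (Adm : StepGuard F) : LocalLetters165TopStepCoreG F N Sup Adm B₃ C θ Q a₀ a₁ :=
  fun ν M g K k s hsep hM₁ _ hk => h ν M g K k s hsep hM₁ hk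

/-- Antitone in the ceilings. [cite: Balaban1985Variational, (165)–(166) p.304 (bookkeeping)] -/
theorem LocalLetters165TopStepCoreG.of_le {Sup : (ν : Stage7Numerics) → (K : ℕ) → (ℕ → Set (Site (F.P K) 0)) → Set (Site (F.P K) 0)} {Adm : StepGuard F}
    {B₃ C θ Q a₀ a₀' a₁ a₁' : ℝ} (h : LocalLetters165TopStepCoreG F N Sup Adm B₃ C θ Q a₀ a₁) (ha₀ : a₀' ≤ a₀) (ha₁ : a₁' ≤ a₁) :
    LocalLetters165TopStepCoreG F N Sup Adm B₃ C θ Q a₀' a₁' :=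
  fun ν M g K k s hsep hM₁ hc hk ε δ hδ hcomp hcomp' hε hεcomp hεcomp' W h7 U h17 h19 hfib hcrit =>
    h ν M g K k s hsep hM₁ hc hk ε δ (fun n hn => ⟨(hδ n hn).1, (hδ n hn).2.trans ha₁⟩) hcomp hcomp'
      (fun n hn => ⟨(hε n hn).1, (hε n hn).2.trans ha₀⟩) hεcomp hεcomp' W h7 U h17 h19 hfib hcrit

/-- Monotone in the guard: a stronger guard only weakens the token. [cite: Balaban1985Variational, (144) p.300 (bookkeeping)] -/
theorem LocalLetters165TopStepCoreG.of_imp {Sup : (ν : Stage7Numerics) → (K : ℕ) → (ℕ → Set (Site (F.P K) 0)) → Set (Site (F.P K) 0)} {Adm Adm' : StepGuard F}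
    {B₃ C θ Q a₀ a₁ : ℝ} (h : LocalLetters165TopStepCoreG F N Sup Adm B₃ C θ Q a₀ a₁) (himp : ∀ ν M g K k s, Adm' ν M g K k s → Adm ν M g K k s) : LocalLetters165TopStepCoreG F N Sup Adm' B₃ C θ Q a₀ a₁ :=
  fun ν M g K k s hsep hM₁ hc' hk => h ν M g K k s hsep hM₁ (himp ν M g K k s hc') hk

/-- ★★ **THE (165)-LETTERS WITH A GUARD CLOSE THE ONE-STEP IMPROVEMENT WITH THE SAME GUARD** (p587134's `halvingStepTopCore_of_localLetters165Core` with the guard threaded): under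
`B₃ ≥ max{128C, 0}`, `θ ≤ 1∕512`, `Q ≥ 0`, `512·Q·a₀ ≤ 1`, `a₀ ≤ ½`, the token gives n07-e's `HalvingStepTopCoreG F N Sup Adm B₃ a₀ a₁` (module 47).
[cite: Balaban1985Variational, (165)–(168) p.304, (162)–(163) pp.303–304, Prop. 8 p.304; Balaban1985RegularSpaces, (1.7)–(1.9) p.77, (1.54) p.85] -/
theorem halvingStepTopCoreG_of_localLetters165CoreG {Sup : (ν : Stage7Numerics) → (K : ℕ) → (ℕ → Set (Site (F.P K) 0)) → Set (Site (F.P K) 0)} {Adm : StepGuard F}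
    {B₃ C θ Q a₀ a₁ : ℝ} (h : LocalLetters165TopStepCoreG F N Sup Adm B₃ C θ Q a₀ a₁) (hB₃ : 0 ≤ B₃) (hC : 128 * C ≤ B₃) (hθ' : 512 * θ ≤ 1)
    (hQ : 0 ≤ Q) (ha : 512 * Q * a₀ ≤ 1) (ha₀ : 2 * a₀ ≤ 1) : HalvingStepTopCoreG F N Sup Adm B₃ a₀ a₁ := by
  intro ν M g K k s hsep hM₁ hc hk ε δ hδ hcomp hcomp' hε hεcomp hεcomp' W h7 U h17 h19 hfib hcrit
  have htok := h ν M g K k s hsep hM₁ hc hk ε δ hδ hcomp hcomp' hε hεcomp hεcomp' W h7 U h17 h19 hfib hcrit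
  have hδpos : ∀ n, n ≤ k → 0 < δ n := fun n hn => (hδ n hn).1
  have hbud : ∀ i, i ≤ k → 64 * (C * δ i + θ * ε i + Q * ε i ^ 2) ≤ max (B₃ * δ i) (ε i / 2) := fun i hi =>
    threshold167_of_budget165 hC hθ' hQ ha (hδ i hi).1 ((mul_nonneg hB₃ (hδ i hi).1.le).trans (hε i hi).1) (hε i hi).2
  refine ⟨fun m hm p hp hpc => ?_, fun m hm b hb hbc => ?_⟩
  · obtain ⟨Y, i, hmi, hik, hpY, hg⟩ := (htok m hm).1 p hp hpc
    obtain ⟨hd, h32, -⟩ := thresholds168' (T4Family.P_d F K) hB₃ (hδpos i hik) (hε i hik) ha₀ (hbud i hik)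
    have hη := eta_pos_le_one' (F.P K) i
    have h1 := (Sect2.regularTwo_of_localGauge10On hg hη.1 hη.2 hd).1 p hpY
    calc dist1 (GaugeField.plaqHol U p) < 32 * (C * δ i + θ * ε i + Q * ε i ^ 2) * (F.P K).eta i ^ 2 := h1
      _ ≤ max (B₃ * δ i) (ε i / 2) * (F.P K).eta i ^ 2 := mul_le_mul_of_nonneg_right h32 (pow_nonneg hη.1.le 2)
      _ ≤ max (B₃ * δ m) (ε m / 2) * (F.P K).eta m ^ 2 := radius_descend (F.P K) hB₃ hδpos hcomp' hεcomp' one_le_two hmi hik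
  · obtain ⟨Y, i, hmi, hik, hbY, hg⟩ := (htok m hm).2 b hb hbc
    obtain ⟨hd, -, h2⟩ := thresholds168' (T4Family.P_d F K) hB₃ (hδpos i hik) (hε i hik) ha₀ (hbud i hik)
    have hη := eta_pos_le_one' (F.P K) i
    have h1 := (Sect2.regularTwo_of_localGauge10On hg hη.1 hη.2 hd).2 b hbY
    calc ‖Sect2.coDivSum U b.src b.dir‖ < 2 * (C * δ i + θ * ε i + Q * ε i ^ 2) * (F.P K).eta i ^ 3 := h1
      _ ≤ max (B₃ * δ i) (ε i / 2) * (F.P K).eta i ^ 3 := mul_le_mul_of_nonneg_right h2 (pow_nonneg hη.1.le 3)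
      _ ≤ max (B₃ * δ m) (ε m / 2) * (F.P K).eta m ^ 3 := radius_descend (F.P K) hB₃ hδpos hcomp' hεcomp' (by norm_num) hmi hik

end Token165R

/-! ## §2  The split (R0′) token with a floor -/

section TokenSplitR

variable (F : T4Family) (N : ℕ) [NeZero N]

/-- **[15] (165) IN A SPLIT LOCAL GAUGE, ROAD R0′ — TOKEN FORM WITH A GUARD `Adm`**: p612069's `LocalLettersSplitTopStepCore` with ONE more binder `Adm ν M g K k s` after `0 < ν.M₁`.
A `Prop`, NEVER asserted. [cite: Balaban1985Variational, (165) p.304, (152) p.301, (159) p.303, (144) p.300] -/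
def LocalLettersSplitTopStepCoreG (Sup : (ν : Stage7Numerics) → (K : ℕ) → (ℕ → Set (Site (F.P K) 0)) → Set (Site (F.P K) 0)) (Adm : StepGuard F)
    (B₃ C θ Q κ a₀ a₁ : ℝ) : Prop :=
  ∀ (ν : Stage7Numerics) (M : ℕ) (g : ℕ → ℝ) (K k : ℕ) (s : SeqOfRecord F ν M g K k), Sect2.SeqSeparated ν.M₁ s → 0 < ν.M₁ → Adm ν M g K k s → 1 ≤ k →
    ∀ (ε δ : ℕ → ℝ),
    (∀ n, n ≤ k → 0 < δ n ∧ δ n ≤ a₁) → (∀ n, n < k → δ n ≤ 2 * δ (n + 1)) → (∀ n, n < k → δ (n + 1) ≤ 2 * δ n) →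
    (∀ n, n ≤ k → B₃ * δ n ≤ ε n ∧ ε n ≤ a₀) → (∀ n, n < k → ε n ≤ 2 * ε (n + 1)) → (∀ n, n < k → ε (n + 1) ≤ 2 * ε n) →
    ∀ W : MSField (F.P K) (SU N), Sect2.DataSmall7PTop (avOfRecord F N K) s.Ω (Sup ν K s.Ω) k δ W →
      ∀ U : GaugeField (F.P K) 0 (SU N),
        (∀ n, n ≤ k → PlaqSmallOn (Sect2.omegaPlaqsTop s.Ω (Sup ν K s.Ω) n) (ε n * (F.P K).eta n ^ 2) U) →
        (∀ n, n ≤ k → Sect2.CoDivSmallOn (Sect2.omegaBondsTop s.Ω (Sup ν K s.Ω) n) (ε n * (F.P K).eta n ^ 3) U) →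
        AgreeOn (genSet s.Ω k) (avgFamily (avOfRecord F N K) U) W →
        IsCritOnFibre F N K (genSet s.Ω k) W U →
        ∀ m, m ≤ k →
          (∀ p ∈ Sect2.omegaPlaqsTop s.Ω (Sup ν K s.Ω) m, p ∉ Sect2.printedPlaqs s.Ω k 0 →
            ∃ (Y : Set (Site (F.P K) 0)) (i : ℕ), m ≤ i ∧ i ≤ k ∧ p ∈ plaqInside Y ∧
              LocalGaugeSplitOn Y ((F.P K).eta i) (κ * ε i) (C * δ i + θ * ε i + Q * ε i ^ 2) U) ∧
          (∀ b ∈ Sect2.omegaBondsTop s.Ω (Sup ν K s.Ω) m, b ∉ Sect2.bondsDeep (s.Ω 1)ᶜ →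
            ∃ (Y : Set (Site (F.P K) 0)) (i : ℕ), m ≤ i ∧ i ≤ k ∧ b ∈ Sect2.bondsDeep Y ∧
              LocalGaugeSplitOn Y ((F.P K).eta i) (κ * ε i) (C * δ i + θ * ε i + Q * ε i ^ 2) U)

variable {F N}

/-- Guard-free ⇒ guarded. [cite: Balaban1985Variational, (165) p.304 (bookkeeping)] -/
theorem LocalLettersSplitTopStepCore.toG {Sup : (ν : Stage7Numerics) → (K : ℕ) → (ℕ → Set (Site (F.P K) 0)) → Set (Site (F.P K) 0)} {B₃ C θ Q κ a₀ a₁ : ℝ}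
    (h : N07LocalLettersSplitCore.LocalLettersSplitTopStepCore F N Sup B₃ C θ Q κ a₀ a₁) (Adm : StepGuard F) : LocalLettersSplitTopStepCoreG F N Sup Adm B₃ C θ Q κ a₀ a₁ :=
  fun ν M g K k s hsep hM₁ _ hk => h ν M g K k s hsep hM₁ hk

/-- Antitone in the ceilings. [cite: Balaban1985Variational, (165)–(166) p.304 (bookkeeping)] -/
theorem LocalLettersSplitTopStepCoreG.of_le {Sup : (ν : Stage7Numerics) → (K : ℕ) → (ℕ → Set (Site (F.P K) 0)) → Set (Site (F.P K) 0)} {Adm : StepGuard F}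
    {B₃ C θ Q κ a₀ a₀' a₁ a₁' : ℝ} (h : LocalLettersSplitTopStepCoreG F N Sup Adm B₃ C θ Q κ a₀ a₁) (ha₀ : a₀' ≤ a₀) (ha₁ : a₁' ≤ a₁) :
    LocalLettersSplitTopStepCoreG F N Sup Adm B₃ C θ Q κ a₀' a₁' :=
  fun ν M g K k s hsep hM₁ hc hk ε δ hδ hcomp hcomp' hε hεcomp hεcomp' W h7 U h17 h19 hfib hcrit =>
    h ν M g K k s hsep hM₁ hc hk ε δ (fun n hn => ⟨(hδ n hn).1, (hδ n hn).2.trans ha₁⟩) hcomp hcomp'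
      (fun n hn => ⟨(hε n hn).1, (hε n hn).2.trans ha₀⟩) hεcomp hεcomp' W h7 U h17 h19 hfib hcrit

/-- Monotone in the guard. [cite: Balaban1985Variational, (144) p.300 (bookkeeping)] -/
theorem LocalLettersSplitTopStepCoreG.of_imp {Sup : (ν : Stage7Numerics) → (K : ℕ) → (ℕ → Set (Site (F.P K) 0)) → Set (Site (F.P K) 0)} {Adm Adm' : StepGuard F}
    {B₃ C θ Q κ a₀ a₁ : ℝ} (h : LocalLettersSplitTopStepCoreG F N Sup Adm B₃ C θ Q κ a₀ a₁) (himp : ∀ ν M g K k s, Adm' ν M g K k s → Adm ν M g K k s) :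
    LocalLettersSplitTopStepCoreG F N Sup Adm' B₃ C θ Q κ a₀ a₁ :=
  fun ν M g K k s hsep hM₁ hc' hk => h ν M g K k s hsep hM₁ (himp ν M g K k s hc') hk

/-- ★★ **THE SPLIT TOKEN WITH A FLOOR CLOSES THE ONE-STEP IMPROVEMENT WITH THE SAME GUARD, ROAD R0′** (p612069's `halvingStepTopCore_of_localLettersSplitCore` with the guard threaded):
under `B₃ ≥ max{4C, 0}`, `θ ≤ 1∕16`, `Q, κ ≥ 0`, `(16Q + 1024κ²)·a₀ ≤ 1`, `32κ·a₀ ≤ 1`, the token gives `HalvingStepTopCoreG F N Sup Adm B₃ a₀ a₁`.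
[cite: Balaban1985Variational, (165)–(168) p.304, (162)–(163) pp.303–304, Prop. 8 p.304; Balaban1985RegularSpaces, (1.7)–(1.9) p.77, (1.54) p.85] -/
theorem halvingStepTopCoreG_of_localLettersSplitCoreG {Sup : (ν : Stage7Numerics) → (K : ℕ) → (ℕ → Set (Site (F.P K) 0)) → Set (Site (F.P K) 0)} {Adm : StepGuard F}
    {B₃ C θ Q κ a₀ a₁ : ℝ} (h : LocalLettersSplitTopStepCoreG F N Sup Adm B₃ C θ Q κ a₀ a₁) (hB₃ : 0 ≤ B₃) (hC : 4 * C ≤ B₃) (hθ : 16 * θ ≤ 1)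
    (hQ : 0 ≤ Q) (hκ : 0 ≤ κ) (ha : (16 * Q + 1024 * κ ^ 2) * a₀ ≤ 1) (hκa : 32 * κ * a₀ ≤ 1) : HalvingStepTopCoreG F N Sup Adm B₃ a₀ a₁ := by
  intro ν M g K k s hsep hM₁ hc hk ε δ hδ hcomp hcomp' hε hεcomp hεcomp' W h7 U h17 h19 hfib hcrit
  have htok := h ν M g K k s hsep hM₁ hc hk ε δ hδ hcomp hcomp' hε hεcomp hεcomp' W h7 U h17 h19 hfib hcrit
  have hδpos : ∀ n, n ≤ k → 0 < δ n := fun n hn => (hδ n hn).1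
  have hε0 : ∀ n, n ≤ k → 0 ≤ ε n := fun n hn => (mul_nonneg hB₃ (hδpos n hn).le).trans (hε n hn).1
  have h32 : ∀ i, i ≤ k → 32 * (κ * ε i) ≤ 1 := fun i hi => by
    calc 32 * (κ * ε i) = 32 * κ * ε i := by ring
      _ ≤ 32 * κ * a₀ := mul_le_mul_of_nonneg_left (hε i hi).2 (by positivity)
      _ ≤ 1 := hκa
  have hd : ((F.P K).d : ℝ) = 4 := by exact_mod_cast T4Family.P_d F K
  refine ⟨fun m hm p hp hpc => ?_, fun m hm b hb hbc => ?_⟩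
  · obtain ⟨Y, i, hmi, hik, hpY, hg⟩ := (htok m hm).1 p hp hpc
    have hη := eta_pos_le_one' (F.P K) i
    have h1 := (regularTwo_of_localGaugeSplitOn hg hη.1 hη.2 (h32 i hik)).1 p hpY
    have hbud := thresholdSplit_plaq hC hθ hQ ha (hδpos i hik) (hε0 i hik) (hε i hik).2
    calc dist1 (GaugeField.plaqHol U p) < (2 * (C * δ i + θ * ε i + Q * ε i ^ 2) + 24 * (κ * ε i) ^ 2) * (F.P K).eta i ^ 2 := h1
      _ ≤ max (B₃ * δ i) (ε i / 2) * (F.P K).eta i ^ 2 := mul_le_mul_of_nonneg_right hbud (pow_nonneg hη.1.le 2)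
      _ ≤ max (B₃ * δ m) (ε m / 2) * (F.P K).eta m ^ 2 := radius_descend (F.P K) hB₃ hδpos hcomp' hεcomp' one_le_two hmi hik
  · obtain ⟨Y, i, hmi, hik, hbY, hg⟩ := (htok m hm).2 b hb hbc
    have hη := eta_pos_le_one' (F.P K) i
    have h1 := (regularTwo_of_localGaugeSplitOn hg hη.1 hη.2 (h32 i hik)).2 b hbY
    have hbud := thresholdSplit_bond hB₃ hC hθ hQ ha (hδpos i hik) (hε0 i hik) (hε i hik).2
    rw [hd] at h1
    calc ‖Sect2.coDivSum U b.src b.dir‖ < (C * δ i + θ * ε i + Q * ε i ^ 2 + 32 * 4 * (κ * ε i) ^ 2) * (F.P K).eta i ^ 3 := h1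
      _ ≤ max (B₃ * δ i) (ε i / 2) * (F.P K).eta i ^ 3 := mul_le_mul_of_nonneg_right hbud (pow_nonneg hη.1.le 3)
      _ ≤ max (B₃ * δ m) (ε m / 2) * (F.P K).eta m ^ 3 := radius_descend (F.P K) hB₃ hδpos hcomp' hεcomp' (by norm_num) hmi hik

end TokenSplitR

/-! ## §3  The per-datum (165)-token with a floor and its reduction -/

section Datum165R

variable (F : T4Family) (N : ℕ) [NeZero N]

/-- **[15] (165) PER DATA CUBE — TOKEN FORM WITH A GUARD `Adm`**: p610759's `DatumGauge165TopStepCore` with ONE more binder `Adm ν M g K k s` after `0 < ν.M₁`.  A `Prop`, NEVER asserted.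
[cite: Balaban1985Variational, (165) p.304, (144) p.300, p.302] -/
def DatumGauge165TopStepCoreG (Sup : (ν : Stage7Numerics) → (K : ℕ) → (ℕ → Set (Site (F.P K) 0)) → Set (Site (F.P K) 0)) (Mc ρ : ℕ) (Adm : StepGuard F)
    (B₃ C θ Q a₀ a₁ : ℝ) : Prop :=
  ∀ (ν : Stage7Numerics) (M : ℕ) (g : ℕ → ℝ) (K k : ℕ) (s : SeqOfRecord F ν M g K k), Sect2.SeqSeparated ν.M₁ s → 0 < ν.M₁ → Adm ν M g K k s → 1 ≤ k →
    ∀ (ε δ : ℕ → ℝ),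
    (∀ n, n ≤ k → 0 < δ n ∧ δ n ≤ a₁) → (∀ n, n < k → δ n ≤ 2 * δ (n + 1)) → (∀ n, n < k → δ (n + 1) ≤ 2 * δ n) →
    (∀ n, n ≤ k → B₃ * δ n ≤ ε n ∧ ε n ≤ a₀) → (∀ n, n < k → ε n ≤ 2 * ε (n + 1)) → (∀ n, n < k → ε (n + 1) ≤ 2 * ε n) →
    ∀ W : MSField (F.P K) (SU N), Sect2.DataSmall7PTop (avOfRecord F N K) s.Ω (Sup ν K s.Ω) k δ W →
      ∀ U : GaugeField (F.P K) 0 (SU N),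
        (∀ n, n ≤ k → PlaqSmallOn (Sect2.omegaPlaqsTop s.Ω (Sup ν K s.Ω) n) (ε n * (F.P K).eta n ^ 2) U) →
        (∀ n, n ≤ k → Sect2.CoDivSmallOn (Sect2.omegaBondsTop s.Ω (Sup ν K s.Ω) n) (ε n * (F.P K).eta n ^ 3) U) →
        AgreeOn (genSet s.Ω k) (avgFamily (avOfRecord F N K) U) W →
        IsCritOnFibre F N K (genSet s.Ω k) W U →
        ∀ j, 1 ≤ j → j ≤ k → ∀ a : Pt (F.P K).d,
          (∃ x y : Pt (F.P K).d, x ∈ cubeExt (side (F.P K).L Mc j) a 0 ∧ cover (F.P K) y ∈ s.Ω j ∧ Within ((3 : ℕ) : ℤ) x y) →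
          Sect2.LocalGauge10On (cover (F.P K) '' box (F.P K).L (cornerP (F.P K) Mc ρ a) (sideP (F.P K) Mc ρ) j)
            ((F.P K).eta j) (C * δ j + θ * ε j + Q * ε j ^ 2) U

variable {F N}

/-- Guard-free ⇒ guarded. [cite: Balaban1985Variational, (165) p.304 (bookkeeping)] -/
theorem DatumGauge165TopStepCore.toG {Sup : (ν : Stage7Numerics) → (K : ℕ) → (ℕ → Set (Site (F.P K) 0)) → Set (Site (F.P K) 0)} {Mc ρ : ℕ} {B₃ C θ Q a₀ a₁ : ℝ}
    (h : N07LocalLettersCoreOfDatumGauges.DatumGauge165TopStepCore F N Sup Mc ρ B₃ C θ Q a₀ a₁) (Adm : StepGuard F) :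
    DatumGauge165TopStepCoreG F N Sup Mc ρ Adm B₃ C θ Q a₀ a₁ :=
  fun ν M g K k s hsep hM₁ _ hk => h ν M g K k s hsep hM₁ hk

/-- Monotone in the guard. [cite: Balaban1985Variational, (144) p.300 (bookkeeping)] -/
theorem DatumGauge165TopStepCoreG.of_imp {Sup : (ν : Stage7Numerics) → (K : ℕ) → (ℕ → Set (Site (F.P K) 0)) → Set (Site (F.P K) 0)} {Mc ρ : ℕ} {Adm Adm' : StepGuard F}
    {B₃ C θ Q a₀ a₁ : ℝ} (h : DatumGauge165TopStepCoreG F N Sup Mc ρ Adm B₃ C θ Q a₀ a₁) (himp : ∀ ν M g K k s, Adm' ν M g K k s → Adm ν M g K k s) :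
    DatumGauge165TopStepCoreG F N Sup Mc ρ Adm' B₃ C θ Q a₀ a₁ :=
  fun ν M g K k s hsep hM₁ hc' hk => h ν M g K k s hsep hM₁ (himp ν M g K k s hc') hk

/-- ★★★ **THE ∃-INTRODUCTION OF THE S6 HEAD WITH A GUARD** (p610759's `localLetters165Core_of_datumGauge165Core` with the guard threaded): for `Mc ≥ 1`, `ρ ≥ L`, the per-datum token
with floor `c` gives the per-plaquette ∕ per-bond token with floor `c`. [cite: Balaban1985Variational, p.304, p.302, (165) p.304; Balaban1985RegularSpaces, (1.7)–(1.9) p.77, (1.2) p.76] -/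
theorem localLetters165CoreG_of_datumGauge165CoreG {Sup : (ν : Stage7Numerics) → (K : ℕ) → (ℕ → Set (Site (F.P K) 0)) → Set (Site (F.P K) 0)}
    {Mc ρ : ℕ} {Adm : StepGuard F} (hMc : 1 ≤ Mc) (hρ : F.L ≤ ρ) {B₃ C θ Q a₀ a₁ : ℝ} (h : DatumGauge165TopStepCoreG F N Sup Mc ρ Adm B₃ C θ Q a₀ a₁) :
    LocalLetters165TopStepCoreG F N Sup Adm B₃ C θ Q a₀ a₁ := by
  intro ν M g K k s hsep hM₁ hc hk ε δ hδ hcomp hcomp' hε hεcomp hεcomp' W h7 U h17 h19 hfib hcrit m hm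
  have hD := h ν M g K k s hsep hM₁ hc hk ε δ hδ hcomp hcomp' hε hεcomp hεcomp' W h7 U h17 h19 hfib hcrit
  have hρK : (F.P K).L ≤ ρ := hρ
  have hS : ∀ j, 0 < side (F.P K).L Mc j := fun j => B14.Eq213MaximalDomains.side_pos (F.P K).L_pos hMc j
  refine ⟨fun p hp hcore => ?_, fun b hb hcore => ?_⟩
  · obtain ⟨j, hmj, hjk, hpj⟩ := Sect2.exists_level_of_core_plaq hk hm hp hcore
    have hj : 1 ≤ j := le_trans (le_max_right m 1) hmj
    obtain ⟨y, hy, hxy⟩ := exists_within_three_of_mem_plaqsOf hpj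
    have hg := hD j hj hjk (cubeIdx (side (F.P K).L Mc j) (lift (F.P K) p.src))
      ⟨lift (F.P K) p.src, y, mem_cubeExt_cubeIdx (hS j) _, hy, hxy⟩
    exact ⟨_, j, le_trans (le_max_left m 1) hmj, hjk, Sect2.mem_plaqInside_cover_box_propCubeP p hj hMc hρK, hg⟩
  · obtain ⟨j, hmj, hjk, hbj⟩ := Sect2.exists_level_of_core_bond hk hm hb hcore
    have hj : 1 ≤ j := le_trans (le_max_right m 1) hmj
    obtain ⟨y, hy, hxy⟩ := exists_within_three_of_not_mem_bondsDeep_compl hbj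
    have hg := hD j hj hjk (cubeIdx (side (F.P K).L Mc j) (lift (F.P K) b.src - fun _ => 1))
      ⟨lift (F.P K) b.src - fun _ => 1, y, mem_cubeExt_cubeIdx (hS j) _, hy, hxy⟩
    exact ⟨_, j, le_trans (le_max_left m 1) hmj, hjk, Sect2.mem_bondsDeep_cover_box_propCubeP b hj hMc hρK, hg⟩

/-- ★★ **THE PER-DATUM (165)-GAUGES WITH A GUARD CLOSE THE ONE-STEP IMPROVEMENT WITH THE SAME GUARD** (composition with §1).
[cite: Balaban1985Variational, (165)–(168) p.304, (162)–(163) pp.303–304, Prop. 8 p.304; Balaban1985RegularSpaces, (1.7)–(1.9) p.77] -/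
theorem halvingStepTopCoreG_of_datumGauge165CoreG {Sup : (ν : Stage7Numerics) → (K : ℕ) → (ℕ → Set (Site (F.P K) 0)) → Set (Site (F.P K) 0)}
    {Mc ρ : ℕ} {Adm : StepGuard F} (hMc : 1 ≤ Mc) (hρ : F.L ≤ ρ) {B₃ C θ Q a₀ a₁ : ℝ} (h : DatumGauge165TopStepCoreG F N Sup Mc ρ Adm B₃ C θ Q a₀ a₁)
    (hB₃ : 0 ≤ B₃) (hC : 128 * C ≤ B₃) (hθ' : 512 * θ ≤ 1) (hQ : 0 ≤ Q) (ha : 512 * Q * a₀ ≤ 1) (ha₀ : 2 * a₀ ≤ 1) :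
    HalvingStepTopCoreG F N Sup Adm B₃ a₀ a₁ :=
  halvingStepTopCoreG_of_localLetters165CoreG (localLetters165CoreG_of_datumGauge165CoreG hMc hρ h) hB₃ hC hθ' hQ ha ha₀

end Datum165R

/-! ## §4  The per-datum split token with a floor and its reduction -/

section DatumSplitR

variable (F : T4Family) (N : ℕ) [NeZero N]

/-- **[15] (165) PER DATA CUBE, SPLIT GAUGE, ROAD R0′ — TOKEN FORM WITH A GUARD `Adm`**: p612069's `DatumGaugeSplitTopStepCore` with ONE more binder `Adm ν M g K k s` after
`0 < ν.M₁`.  A `Prop`, NEVER asserted. [cite: Balaban1985Variational, (165) p.304, (144) p.300, (152) p.301, (159) p.303] -/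
def DatumGaugeSplitTopStepCoreG (Sup : (ν : Stage7Numerics) → (K : ℕ) → (ℕ → Set (Site (F.P K) 0)) → Set (Site (F.P K) 0)) (Mc ρ : ℕ) (Adm : StepGuard F)
    (B₃ C θ Q κ a₀ a₁ : ℝ) : Prop :=
  ∀ (ν : Stage7Numerics) (M : ℕ) (g : ℕ → ℝ) (K k : ℕ) (s : SeqOfRecord F ν M g K k), Sect2.SeqSeparated ν.M₁ s → 0 < ν.M₁ → Adm ν M g K k s → 1 ≤ k →
    ∀ (ε δ : ℕ → ℝ),
    (∀ n, n ≤ k → 0 < δ n ∧ δ n ≤ a₁) → (∀ n, n < k → δ n ≤ 2 * δ (n + 1)) → (∀ n, n < k → δ (n + 1) ≤ 2 * δ n) →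
    (∀ n, n ≤ k → B₃ * δ n ≤ ε n ∧ ε n ≤ a₀) → (∀ n, n < k → ε n ≤ 2 * ε (n + 1)) → (∀ n, n < k → ε (n + 1) ≤ 2 * ε n) →
    ∀ W : MSField (F.P K) (SU N), Sect2.DataSmall7PTop (avOfRecord F N K) s.Ω (Sup ν K s.Ω) k δ W →
      ∀ U : GaugeField (F.P K) 0 (SU N),
        (∀ n, n ≤ k → PlaqSmallOn (Sect2.omegaPlaqsTop s.Ω (Sup ν K s.Ω) n) (ε n * (F.P K).eta n ^ 2) U) →
        (∀ n, n ≤ k → Sect2.CoDivSmallOn (Sect2.omegaBondsTop s.Ω (Sup ν K s.Ω) n) (ε n * (F.P K).eta n ^ 3) U) →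
        AgreeOn (genSet s.Ω k) (avgFamily (avOfRecord F N K) U) W →
        IsCritOnFibre F N K (genSet s.Ω k) W U →
        ∀ j, 1 ≤ j → j ≤ k → ∀ a : Pt (F.P K).d,
          (∃ x y : Pt (F.P K).d, x ∈ cubeExt (side (F.P K).L Mc j) a 0 ∧ cover (F.P K) y ∈ s.Ω j ∧ Within ((3 : ℕ) : ℤ) x y) →
          LocalGaugeSplitOn (cover (F.P K) '' box (F.P K).L (cornerP (F.P K) Mc ρ a) (sideP (F.P K) Mc ρ) j)
            ((F.P K).eta j) (κ * ε j) (C * δ j + θ * ε j + Q * ε j ^ 2) U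

variable {F N}

/-- Guard-free ⇒ guarded. [cite: Balaban1985Variational, (165) p.304 (bookkeeping)] -/
theorem DatumGaugeSplitTopStepCore.toG {Sup : (ν : Stage7Numerics) → (K : ℕ) → (ℕ → Set (Site (F.P K) 0)) → Set (Site (F.P K) 0)} {Mc ρ : ℕ} {B₃ C θ Q κ a₀ a₁ : ℝ}
    (h : N07LocalLettersSplitCore.DatumGaugeSplitTopStepCore F N Sup Mc ρ B₃ C θ Q κ a₀ a₁) (Adm : StepGuard F) :
    DatumGaugeSplitTopStepCoreG F N Sup Mc ρ Adm B₃ C θ Q κ a₀ a₁ :=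
  fun ν M g K k s hsep hM₁ _ hk => h ν M g K k s hsep hM₁ hk

/-- Monotone in the guard. [cite: Balaban1985Variational, (144) p.300 (bookkeeping)] -/
theorem DatumGaugeSplitTopStepCoreG.of_imp {Sup : (ν : Stage7Numerics) → (K : ℕ) → (ℕ → Set (Site (F.P K) 0)) → Set (Site (F.P K) 0)} {Mc ρ : ℕ} {Adm Adm' : StepGuard F}
    {B₃ C θ Q κ a₀ a₁ : ℝ} (h : DatumGaugeSplitTopStepCoreG F N Sup Mc ρ Adm B₃ C θ Q κ a₀ a₁) (himp : ∀ ν M g K k s, Adm' ν M g K k s → Adm ν M g K k s) :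
    DatumGaugeSplitTopStepCoreG F N Sup Mc ρ Adm' B₃ C θ Q κ a₀ a₁ :=
  fun ν M g K k s hsep hM₁ hc' hk => h ν M g K k s hsep hM₁ (himp ν M g K k s hc') hk

/-- ★★★ **THE ∃-INTRODUCTION OF THE S6 HEAD WITH A GUARD, SPLIT EDITION** (p612069's `localLettersSplitCore_of_datumGaugeSplitCore` with the guard threaded).
[cite: Balaban1985Variational, p.304, p.302, (165) p.304; Balaban1985RegularSpaces, (1.7)–(1.9) p.77, (1.2) p.76] -/
theorem localLettersSplitCoreG_of_datumGaugeSplitCoreG {Sup : (ν : Stage7Numerics) → (K : ℕ) → (ℕ → Set (Site (F.P K) 0)) → Set (Site (F.P K) 0)}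
    {Mc ρ : ℕ} {Adm : StepGuard F} (hMc : 1 ≤ Mc) (hρ : F.L ≤ ρ) {B₃ C θ Q κ a₀ a₁ : ℝ} (h : DatumGaugeSplitTopStepCoreG F N Sup Mc ρ Adm B₃ C θ Q κ a₀ a₁) :
    LocalLettersSplitTopStepCoreG F N Sup Adm B₃ C θ Q κ a₀ a₁ := by
  intro ν M g K k s hsep hM₁ hc hk ε δ hδ hcomp hcomp' hε hεcomp hεcomp' W h7 U h17 h19 hfib hcrit m hm
  have hD := h ν M g K k s hsep hM₁ hc hk ε δ hδ hcomp hcomp' hε hεcomp hεcomp' W h7 U h17 h19 hfib hcrit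
  have hρK : (F.P K).L ≤ ρ := hρ
  have hS : ∀ j, 0 < side (F.P K).L Mc j := fun j => B14.Eq213MaximalDomains.side_pos (F.P K).L_pos hMc j
  refine ⟨fun p hp hcore => ?_, fun b hb hcore => ?_⟩
  · obtain ⟨j, hmj, hjk, hpj⟩ := Sect2.exists_level_of_core_plaq hk hm hp hcore
    have hj : 1 ≤ j := le_trans (le_max_right m 1) hmj
    obtain ⟨y, hy, hxy⟩ := exists_within_three_of_mem_plaqsOf hpj
    have hg := hD j hj hjk (cubeIdx (side (F.P K).L Mc j) (lift (F.P K) p.src))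
      ⟨lift (F.P K) p.src, y, mem_cubeExt_cubeIdx (hS j) _, hy, hxy⟩
    exact ⟨_, j, le_trans (le_max_left m 1) hmj, hjk, Sect2.mem_plaqInside_cover_box_propCubeP p hj hMc hρK, hg⟩
  · obtain ⟨j, hmj, hjk, hbj⟩ := Sect2.exists_level_of_core_bond hk hm hb hcore
    have hj : 1 ≤ j := le_trans (le_max_right m 1) hmj
    obtain ⟨y, hy, hxy⟩ := exists_within_three_of_not_mem_bondsDeep_compl hbj
    have hg := hD j hj hjk (cubeIdx (side (F.P K).L Mc j) (lift (F.P K) b.src - fun _ => 1))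
      ⟨lift (F.P K) b.src - fun _ => 1, y, mem_cubeExt_cubeIdx (hS j) _, hy, hxy⟩
    exact ⟨_, j, le_trans (le_max_left m 1) hmj, hjk, Sect2.mem_bondsDeep_cover_box_propCubeP b hj hMc hρK, hg⟩

/-- ★★ **THE PER-DATUM SPLIT GAUGES WITH A GUARD CLOSE THE ONE-STEP IMPROVEMENT WITH THE SAME GUARD, ROAD R0′** (composition with §2).
[cite: Balaban1985Variational, (165)–(168) p.304, (162)–(163) pp.303–304, Prop. 8 p.304; Balaban1985RegularSpaces, (1.7)–(1.9) p.77, (1.54) p.85] -/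
theorem halvingStepTopCoreG_of_datumGaugeSplitCoreG {Sup : (ν : Stage7Numerics) → (K : ℕ) → (ℕ → Set (Site (F.P K) 0)) → Set (Site (F.P K) 0)}
    {Mc ρ : ℕ} {Adm : StepGuard F} (hMc : 1 ≤ Mc) (hρ : F.L ≤ ρ) {B₃ C θ Q κ a₀ a₁ : ℝ} (h : DatumGaugeSplitTopStepCoreG F N Sup Mc ρ Adm B₃ C θ Q κ a₀ a₁)
    (hB₃ : 0 ≤ B₃) (hC : 4 * C ≤ B₃) (hθ : 16 * θ ≤ 1) (hQ : 0 ≤ Q) (hκ : 0 ≤ κ) (ha : (16 * Q + 1024 * κ ^ 2) * a₀ ≤ 1)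
    (hκa : 32 * κ * a₀ ≤ 1) : HalvingStepTopCoreG F N Sup Adm B₃ a₀ a₁ :=
  halvingStepTopCoreG_of_localLettersSplitCoreG (localLettersSplitCoreG_of_datumGaugeSplitCoreG hMc hρ h) hB₃ hC hθ hQ hκ ha hκa

end DatumSplitR

/-! ## §5  The `floorGuard` bridges to the floor-carrying editions (p621398) -/

section Bridges

variable {F : T4Family} {N : ℕ} [NeZero N]

/-- `…R c ↔ …G (floorGuard c)` for the (165)-token (definitional). [cite: Balaban1985RegularSpaces, (1.3)–(1.6) p.77 (bookkeeping)] -/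
theorem localLetters165TopStepCoreR_iff_G_floorGuard {Sup : (ν : Stage7Numerics) → (K : ℕ) → (ℕ → Set (Site (F.P K) 0)) → Set (Site (F.P K) 0)} {c : ℕ}
    {B₃ C θ Q a₀ a₁ : ℝ} : LocalLetters165TopStepCoreR F N Sup c B₃ C θ Q a₀ a₁ ↔ LocalLetters165TopStepCoreG F N Sup (floorGuard F c) B₃ C θ Q a₀ a₁ :=
  Iff.rfl

/-- `…R c ↔ …G (floorGuard c)` for the split token (definitional). [cite: Balaban1985RegularSpaces, (1.3)–(1.6) p.77 (bookkeeping)] -/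
theorem localLettersSplitTopStepCoreR_iff_G_floorGuard {Sup : (ν : Stage7Numerics) → (K : ℕ) → (ℕ → Set (Site (F.P K) 0)) → Set (Site (F.P K) 0)} {c : ℕ}
    {B₃ C θ Q κ a₀ a₁ : ℝ} : LocalLettersSplitTopStepCoreR F N Sup c B₃ C θ Q κ a₀ a₁ ↔ LocalLettersSplitTopStepCoreG F N Sup (floorGuard F c) B₃ C θ Q κ a₀ a₁ :=
  Iff.rfl

/-- `…R c ↔ …G (floorGuard c)` for the per-datum (165)-token (definitional). [cite: Balaban1985RegularSpaces, (1.3)–(1.6) p.77 (bookkeeping)] -/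
theorem datumGauge165TopStepCoreR_iff_G_floorGuard {Sup : (ν : Stage7Numerics) → (K : ℕ) → (ℕ → Set (Site (F.P K) 0)) → Set (Site (F.P K) 0)} {Mc ρ c : ℕ}
    {B₃ C θ Q a₀ a₁ : ℝ} : DatumGauge165TopStepCoreR F N Sup Mc ρ c B₃ C θ Q a₀ a₁ ↔ DatumGauge165TopStepCoreG F N Sup Mc ρ (floorGuard F c) B₃ C θ Q a₀ a₁ :=
  Iff.rfl

/-- `…R c ↔ …G (floorGuard c)` for the per-datum split token (definitional). [cite: Balaban1985RegularSpaces, (1.3)–(1.6) p.77 (bookkeeping)] -/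
theorem datumGaugeSplitTopStepCoreR_iff_G_floorGuard {Sup : (ν : Stage7Numerics) → (K : ℕ) → (ℕ → Set (Site (F.P K) 0)) → Set (Site (F.P K) 0)} {Mc ρ c : ℕ}
    {B₃ C θ Q κ a₀ a₁ : ℝ} :
    DatumGaugeSplitTopStepCoreR F N Sup Mc ρ c B₃ C θ Q κ a₀ a₁ ↔ DatumGaugeSplitTopStepCoreG F N Sup Mc ρ (floorGuard F c) B₃ C θ Q κ a₀ a₁ :=
  Iff.rfl

end Bridges

end Summit.QuantumFields.YangMills.BalabanUVNodes.N07LocalLettersCoreGuarded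

end
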